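import Summits.BirchSwinnertonDyer.BirchSwinnertonDyer.Theorems.ManinLocalTwoThreePinningNinetyNine
import Summits.BirchSwinnertonDyer.BirchSwinnertonDyer.Theorems.ManinLocalTwoThreePinningKernelRows
import Summits.BirchSwinnertonDyer.BirchSwinnertonDyer.Theorems.ManinLocalTwoThreePinningOneSeventySixRows
import HarnessLib

/-!
# Level 99: THE ROW `99d = 11a ⊗ χ₋₃` — `a₂(W) = 2 ⇒ D.f = (φ₁₁)^{χ₋₃}` for every `X₀(99)`-datum (part 3 of 3)

Cell `bsd-f2-manin`, route `ManinLocalTwoThree`, crux C3 `ManinPrimeToThreeAtNine` (stmt-BirchSwinnertonDyer-22968, `9 ∣ 99`), an g59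
(LENS analytic/periods); `--supports stmt-BirchSwinnertonDyer-22967` (helper).  ANSWERS p3's ask A-p3→an-99: the hypothesis-shaped row
«`D.f = (ι₁φ₁₁)^{χ₋₃}`» that p3 g26's transport `68.A` and the landed squeeze `RootSqueezeElevenNinetyNine.periodLatticeLe_iota99_phi11`
consume for the class `99d`.
From part 2's `pinning_cusp` (6 certificates in `S₂(Γ₀(99))`, all `d′ = 1`) and part F's row identity `eq_of_smul_eq_sum_of_row` in
`V = S₂(Γ₀(99))`: the certificate of `99d` is `y = e₆`, i.e. `D.f = χ·h0` with `h0 = η₁²η₁₁²`; the target form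
`Φ = charTwist 99 (11 ∣ 99) (3² ∣ 99) (·/3) φ₁₁` (`φ₁₁ = cuspFormEtaProductEleven`, the LEVEL-11 form twisted up to level 99) has the
certified table `tabTd[n] = chi3 n · tabPhi11[n]` (`n < 48`; `tabPhi11` = an g55's level-11 table, `PinningOneSeventySix.tabPhi11_eq_cuspCoeff`)
and `tabTd = tabs 6` — one decidable row identity.  The row is SELECTED BY `a₂(W) = 2` (the six certificates have
`a₂ = −2, −1, −1, 1, 1, 2`).  Also: `lFunction_two_five_cases` — `(a₂(W), a₅(W)) ∈ {(−2,1), (−1,−4), (−1,2), (1,−2), (1,4), (2,−1)}` for every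
`X₀(99)`-datum (the pairs `(−2,1)` and `(1,−2)` are the `3`-depleted old classes `11a`, `33a`: `U₃`-eigenvalue-`0` oldforms that the linear sieve
cannot exclude; a COMPLETE level-99 assembly must dismiss them by newness, exactly as at level 171).
HONEST FRAMING: unconditional, standard axioms; a row identification, nothing about periods or `c`; nothing here proves C2/C3, Manin's
conjecture or BSD.
[cite: CremonaAlgorithms1997, §2.10, Table 1 (99d, 11a)] [cite: Shimura1971, Prop. 3.64] [cite: DiamondShurman2005, Thm. 3.5.1] [cite: Koehler2011, §2.1]
-/

set_option autoImplicit false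
-- lint-debt: the directory name repeats the summit name (sibling precedent `ManinLocalTwoThreePinningOneSeventySixRows.lean`)
set_option linter.dupNamespace false

noncomputable section

open Complex
open UpperHalfPlane hiding I
open scoped MatrixGroups ModularForm
open ModularForm CongruenceSubgroup PowerSeries
open Literature.NumberTheory.ModularForms
open Literature.NumberTheory.EllipticCurves Literature.NumberTheory.EllipticCurves.ModularForms

namespace Summit.BirchSwinnertonDyer.BirchSwinnertonDyer.Theorems.ManinLocalTwoThree.PinningNinetyNine

open Summit.BirchSwinnertonDyer.BirchSwinnertonDyer.Theorems.ManinLocalTwoThree.BracketSturm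
open Summit.BirchSwinnertonDyer.BirchSwinnertonDyer.Theorems.ManinLocalTwoThree.PinningKernel
open Summit.BirchSwinnertonDyer.BirchSwinnertonDyer.Theorems.ManinLocalTwoThree.PinningOneSeventySix (tabPhi11 tabPhi11_eq_cuspCoeff)

/-! ## §1 The six certificates as named rows; the stage primes -/

/-- Certificate `11a⁰` (the `3`-depleted old class `11a`: `(a₂,a₅) = (−2,1)`; `y`: `h0 + h1 + 3h2`). [folklore] -/
def rowO11 : List (ℕ × ℤ) × ℤ × List ℤ := ([(3, 0), (2, -2), (11, 1), (13, 4), (5, 1), (7, -2)], 1, [1, 1, 3, 0, 0, 0, 0, 0, 0])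

/-- Certificate `99a` (`(a₂,a₅) = (−1,−4)`; `y`: `−χ·h0 − 3χ·h3 + 2χ·h5`). [cite: CremonaAlgorithms1997, Table 1 (99a)] -/
def rowA : List (ℕ × ℤ) × ℤ × List ℤ := ([(3, 0), (2, -1), (11, -1), (13, -2), (5, -4), (7, -2)], 1, [0, 0, 0, 0, 0, 0, -1, -3, 2])

/-- Certificate `99b` (`(a₂,a₅) = (−1,2)`; `y`: `χ·h0 + 3χ·h3`). [cite: CremonaAlgorithms1997, Table 1 (99b)] -/
def rowB : List (ℕ × ℤ) × ℤ × List ℤ := ([(3, 0), (2, -1), (11, -1), (13, -2), (5, 2), (7, 4)], 1, [0, 0, 0, 0, 0, 0, 1, 3, 0])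

/-- Certificate `33a⁰` (the `3`-depleted old class `33a`: `(a₂,a₅) = (1,−2)`). [folklore] -/
def rowO33 : List (ℕ × ℤ) × ℤ × List ℤ := ([(3, 0), (2, 1), (11, 1), (13, -2), (5, -2), (7, 4)], 1, [1, 4, 3, 3, 3, 0, 0, 0, 0])

/-- Certificate `99c` (`(a₂,a₅) = (1,4)`; a PLAIN `η` combination `−h0 − 8h1 − 9h2 − 3h3 − 9h4 + 2h5`). [cite: CremonaAlgorithms1997, Table 1 (99c)] -/
def rowC : List (ℕ × ℤ) × ℤ × List ℤ := ([(3, 0), (2, 1), (11, 1), (13, -2), (5, 4), (7, -2)], 1, [-1, -8, -9, -3, -9, 2, 0, 0, 0])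

/-- Certificate `99d = 11a ⊗ χ₋₃` (`(a₂,a₅) = (2,−1)`; `y = e₆`: `χ·h0`). [cite: CremonaAlgorithms1997, Table 1 (99d)] -/
def rowD : List (ℕ × ℤ) × ℤ × List ℤ := ([(3, 0), (2, 2), (11, -1), (13, 4), (5, -1), (7, -2)], 1, [0, 0, 0, 0, 0, 0, 1, 0, 0])

/-- Part 1's `certs` is this list of rows. [folklore] -/
theorem certs_eq_rows : certs = [rowO11, rowA, rowB, rowO33, rowC, rowD] := rfl

/-- The stage primes, in sieve order. [folklore] -/
theorem stages_map_fst : stages.map Prod.fst = [3, 2, 11, 13, 5, 7] := rfl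

/-! ## §2 The target form `(φ₁₁)^{χ₋₃}` and its certified table -/

/-- `aₙ((φ₁₁)^{χ₋₃}) = chi3 n · aₙ(φ₁₁)`, `n < 48`. [cite: Shimura1971, Prop. 3.64] -/
def tabTd : List ℤ :=
  [0, 1, 2, 0, 2, -1, 0, -2, 0, 0, -2, -1, 0, 4, -4, 0, -4, 2, 0, 0, -2, 0, -2, 1, 0, -4, 8, 0, -4, 0, 0, 7, -8, 0, 4, 2, 0, 3, 0, 0, 0, 8, 0, -6, -2, 0, 2, -8]

/-- The twist identity `tabTd[n] = chi3 n · tabPhi11[n]`, `n < 48`. [folklore] -/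
theorem hTd : ∀ n < 48, tabTd.getD n 0 = chi3 n * tabPhi11.getD n 0 := by
  decide +kernel

/-- **`(φ₁₁)^{χ₋₃}` as a cusp form of level `99`**: the tree's `charTwist` of the LEVEL-11 form `φ₁₁ = η₁²η₁₁²` (`11 ∣ 99`, `3² ∣ 99`).
[cite: Shimura1971, Prop. 3.64] -/
def phi11Twist : CuspForm (Gamma0 99) 2 :=
  charTwist 99 (⟨9, rfl⟩ : 11 ∣ 99) (⟨11, rfl⟩ : 3 ^ 2 ∣ 99) (isQuadratic_quadraticChar_ringHomComp 3) cuspFormEtaProductEleven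

/-- `phi11Twist` unfolds to the `charTwist` term. [folklore] -/
theorem phi11Twist_def : phi11Twist =
    charTwist 99 (⟨9, rfl⟩ : 11 ∣ 99) (⟨11, rfl⟩ : 3 ^ 2 ∣ 99) (isQuadratic_quadraticChar_ringHomComp 3) cuspFormEtaProductEleven := rfl

/-- **`aₙ((φ₁₁)^{χ₋₃}) = (·/3)(n)·aₙ(φ₁₁)` for ALL `n`.** [cite: Shimura1971, Prop. 3.64] -/
theorem cuspCoeff_phi11Twist (n : ℕ) : cuspCoeff phi11Twist n = ((chi3 n : ℤ) : ℂ) * cuspCoeff cuspFormEtaProductEleven n := by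
  rw [phi11Twist_def, cuspCoeff_charTwist (L := 99) (hN := ⟨9, rfl⟩) (hm := ⟨11, rfl⟩) (hχ := isQuadratic_quadraticChar_ringHomComp 3)
    (hprim := isPrimitive_quadraticChar_ringHomComp 3 (by norm_num)) (f := cuspFormEtaProductEleven) (n := n),
    quadraticChar_three_apply]

/-- **Certified table of `(φ₁₁)^{χ₋₃}` to depth `48`.** [cite: Shimura1971, Prop. 3.64] [cite: Koehler2011, §2.1] -/
theorem tabTd_eq_cuspCoeff : ∀ n < 48, ((tabTd.getD n 0 : ℤ) : ℂ) = cuspCoeff phi11Twist n := by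
  intro n hn
  rw [cuspCoeff_phi11Twist, hTd n hn, ← tabPhi11_eq_cuspCoeff n (by omega)]
  push_cast
  ring

/-- **Row identity `99d`**: `1·tabTd[n] = Σ_j y_j·tabs_j[n]` (`= tabs 6 [n]`), `n < 48`. [folklore] -/
theorem hrowD : ∀ n < 48, rowD.2.1 * tabTd.getD n 0 = ∑ j : Fin 9, rowD.2.2.getD (j : ℕ) 0 * (tabs j).getD n 0 := by
  decide +kernel

/-! ## §3 Reading `a₂`, `a₅` off the truth row; the tables of the seeds -/

/-- `a₂(W)` read off a truth row. [folklore] -/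
theorem lFunction_two_of_truth {W : WeierstrassCurve ℚ} [W.IsElliptic] (row : List (ℕ × ℤ) × ℤ × List ℤ)
    (h : truth W [3, 2, 11, 13, 5, 7] = row.1) : W.LFunction 2 = (row.1.getD 1 (0, 0)).2 := by
  have h' := congrArg (fun l : List (ℕ × ℤ) ↦ (l.getD 1 (0, 0)).2) h
  simpa [truth] using h'

/-- `a₅(W)` read off a truth row. [folklore] -/
theorem lFunction_five_of_truth {W : WeierstrassCurve ℚ} [W.IsElliptic] (row : List (ℕ × ℤ) × ℤ × List ℤ)
    (h : truth W [3, 2, 11, 13, 5, 7] = row.1) : W.LFunction 5 = (row.1.getD 4 (0, 0)).2 := by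
  have h' := congrArg (fun l : List (ℕ × ℤ) ↦ (l.getD 4 (0, 0)).2) h
  simpa [truth] using h'

/-- The seed tables from the values clause of `pinning_cusp` (sparse `η` certificates of part 1). [cite: Koehler2011, §2.1] -/
theorem stabs_eq_cuspCoeff (S : Fin 6 → CuspForm (Gamma0 99) 2) (hS : ∀ i, ∀ τ : ℍ, S i τ = etaQuotient 99 (expFn (Ls[(i : ℕ)]).1) τ) :
    ∀ i, ∀ m < 48, (((stabs i).getD m 0 : ℤ) : ℂ) = cuspCoeff (S i) m := by
  obtain ⟨C, hCS⟩ : ∃ C : Fin 6 → ModularForm (Gamma0 99) 2, ∀ i, ModularFormClass.modularForm (S i) = C i :=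
    ⟨_, fun _ ↦ rfl⟩
  have hC : ∀ i, ∀ τ : ℍ, C i τ = etaQuotient 99 (expFn (Ls[(i : ℕ)]).1) τ := fun i τ ↦ by rw [← hCS]; exact hS i τ
  have ht := tables_of_etaCertsSparse 99 48 (fun i : Fin 6 ↦ expFn (Ls[(i : ℕ)]).1) (fun i ↦ shifts i) stabs C hC hshift hcert
  exact fun i m hm ↦ by rw [← modCoefₗ_modularForm (S i) m, hCS]; exact ht i m hm

/-! ## §4 The rows -/

/-- **`(a₂(W), a₅(W))` for every `X₀(99)`-datum** lies in `{(−2,1), (−1,−4), (−1,2), (1,−2), (1,4), (2,−1)}` (certificates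
`11a⁰, 99a, 99b, 33a⁰, 99c, 99d`). [cite: CremonaAlgorithms1997, Table 1 (99a–d)] -/
theorem lFunction_two_five_cases {W : WeierstrassCurve ℚ} [W.IsElliptic] (D : ModularParametrizationData W 99) :
    (W.LFunction 2 = -2 ∧ W.LFunction 5 = 1) ∨ (W.LFunction 2 = -1 ∧ W.LFunction 5 = -4) ∨ (W.LFunction 2 = -1 ∧ W.LFunction 5 = 2) ∨
      (W.LFunction 2 = 1 ∧ W.LFunction 5 = -2) ∨ (W.LFunction 2 = 1 ∧ W.LFunction 5 = 4) ∨ (W.LFunction 2 = 2 ∧ W.LFunction 5 = -1) := by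
  obtain ⟨S, -, c, hc, htruth, -⟩ := pinning_cusp D
  rw [stages_map_fst] at htruth
  rw [certs_eq_rows] at hc
  simp only [List.mem_cons, List.mem_nil_iff, or_false] at hc
  rcases hc with rfl | rfl | rfl | rfl | rfl | rfl
  · exact Or.inl ⟨by simpa [rowO11] using lFunction_two_of_truth rowO11 htruth, by simpa [rowO11] using lFunction_five_of_truth rowO11 htruth⟩
  · exact Or.inr (Or.inl ⟨by simpa [rowA] using lFunction_two_of_truth rowA htruth, by simpa [rowA] using lFunction_five_of_truth rowA htruth⟩)
  · exact Or.inr (Or.inr (Or.inl ⟨by simpa [rowB] using lFunction_two_of_truth rowB htruth,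
      by simpa [rowB] using lFunction_five_of_truth rowB htruth⟩))
  · exact Or.inr (Or.inr (Or.inr (Or.inl ⟨by simpa [rowO33] using lFunction_two_of_truth rowO33 htruth,
      by simpa [rowO33] using lFunction_five_of_truth rowO33 htruth⟩)))
  · exact Or.inr (Or.inr (Or.inr (Or.inr (Or.inl ⟨by simpa [rowC] using lFunction_two_of_truth rowC htruth,
      by simpa [rowC] using lFunction_five_of_truth rowC htruth⟩))))
  · exact Or.inr (Or.inr (Or.inr (Or.inr (Or.inr ⟨by simpa [rowD] using lFunction_two_of_truth rowD htruth,
      by simpa [rowD] using lFunction_five_of_truth rowD htruth⟩))))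

/-- **THE ROW `99d`: `a₂(W) = 2 ⇒ D.f = (φ₁₁)^{χ₋₃}`** — for every `X₀(99)`-datum `D` of an elliptic `W/ℚ` with `a₂(W) = 2`, the newform
`D.f` IS the tree's `charTwist 99 (11 ∣ 99) (3² ∣ 99) (·/3) φ₁₁` (an explicit root form at level `11`; no root datum needed).
[cite: CremonaAlgorithms1997, Table 1 (99d, 11a)] [cite: Shimura1971, Prop. 3.64] [cite: DiamondShurman2005, Thm. 3.5.1] -/
theorem f_eq_phi11Twist_of_lFunction_two {W : WeierstrassCurve ℚ} [W.IsElliptic] (D : ModularParametrizationData W 99)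
    (h2 : W.LFunction 2 = 2) : D.f = phi11Twist := by
  haveI : FiniteDimensional ℂ (CuspForm (Gamma0 99) 2) := finiteDimensional_cuspForm_gamma0 99 2
  obtain ⟨S, hS, c, hc, htruth, hpin⟩ := pinning_cusp D
  have hs := stabs_eq_cuspCoeff S hS
  rw [stages_map_fst] at htruth
  rw [certs_eq_rows] at hc
  simp only [List.mem_cons, List.mem_nil_iff, or_false] at hc
  rcases hc with rfl | rfl | rfl | rfl | rfl | rfl
  · have h' := lFunction_two_of_truth rowO11 htruth
    simp only [rowO11, List.getD_cons_succ, List.getD_cons_zero] at h'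
    omega
  · have h' := lFunction_two_of_truth rowA htruth
    simp only [rowA, List.getD_cons_succ, List.getD_cons_zero] at h'
    omega
  · have h' := lFunction_two_of_truth rowB htruth
    simp only [rowB, List.getD_cons_succ, List.getD_cons_zero] at h'
    omega
  · have h' := lFunction_two_of_truth rowO33 htruth
    simp only [rowO33, List.getD_cons_succ, List.getD_cons_zero] at h'
    omega
  · have h' := lFunction_two_of_truth rowC htruth
    simp only [rowC, List.getD_cons_succ, List.getD_cons_zero] at h'
    omega
  · exact eq_of_smul_eq_sum_of_row (basis S) tabs duals 12 (htabs S hs) hlen hdual (by norm_num) finrank_cuspForm_two _ tabTd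
      (fun n hn ↦ by rw [cuspCoeffₗ_apply]; exact tabTd_eq_cuspCoeff n hn) rowD.2.1 (by decide) rowD.2.2 hpin hrowD

/-- **The row in `charTwist` form** (p3's «`D.f = (ι₁φ₁₁)^{χ₋₃}`»). [cite: CremonaAlgorithms1997, Table 1 (99d, 11a)] -/
theorem f_eq_charTwist_eleven_of_lFunction_two {W : WeierstrassCurve ℚ} [W.IsElliptic] (D : ModularParametrizationData W 99)
    (h2 : W.LFunction 2 = 2) :
    D.f = charTwist 99 (⟨9, rfl⟩ : 11 ∣ 99) (⟨11, rfl⟩ : 3 ^ 2 ∣ 99) (isQuadratic_quadraticChar_ringHomComp 3) cuspFormEtaProductEleven :=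
  f_eq_phi11Twist_of_lFunction_two D h2

/-- **The row as coefficients**: `a₂(W) = 2 ⇒ aₙ(D.f) = (·/3)(n)·aₙ(φ₁₁)` for ALL `n`. [cite: CremonaAlgorithms1997, Table 1 (99d, 11a)] -/
theorem cuspCoeff_f_eq_chi3_mul_of_lFunction_two {W : WeierstrassCurve ℚ} [W.IsElliptic] (D : ModularParametrizationData W 99)
    (h2 : W.LFunction 2 = 2) (n : ℕ) : cuspCoeff D.f n = ((chi3 n : ℤ) : ℂ) * cuspCoeff cuspFormEtaProductEleven n := by
  rw [f_eq_phi11Twist_of_lFunction_two D h2, cuspCoeff_phi11Twist]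

/-- **… and as `L`-coefficients of `W`**: `a₂(W) = 2 ⇒ aₙ(W) = (·/3)(n)·aₙ(φ₁₁)`. [cite: CremonaAlgorithms1997, Table 1 (99d, 11a)] -/
theorem lFunction_eq_chi3_mul_of_lFunction_two {W : WeierstrassCurve ℚ} [W.IsElliptic] (D : ModularParametrizationData W 99)
    (h2 : W.LFunction 2 = 2) (n : ℕ) : ((W.LFunction n : ℤ) : ℂ) = ((chi3 n : ℤ) : ℂ) * cuspCoeff cuspFormEtaProductEleven n := by
  rw [← D.isNewformOf.2 n, cuspCoeff_f_eq_chi3_mul_of_lFunction_two D h2]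

end Summit.BirchSwinnertonDyer.BirchSwinnertonDyer.Theorems.ManinLocalTwoThree.PinningNinetyNine

end
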